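import Mathlib.Analysis.SpecialFunctions.Pow.Real
import Mathlib.Analysis.SpecialFunctions.Log.Basic
import Mathlib.Algebra.BigOperators.Ring.Finset
import HarnessLib

/-!
# Joshi, *Arithmetic Teichmüller spaces II* [J-II] — A: Mochizuki's Ansatz `Σ_F`, valuation scaling, Teichmüller lifts

Record file of the abc-iut cell, branch E «type Joshi's construction, test vs S» (rung LADDER-ABC:A2.E; seat
abc-iut-E-t2; plan/E/README.md). TAKES NO SIDE on [IUTchIII] Cor. 3.12, on Joshi's claims, or on Mochizuki's report
on them; typed ≠ proved ≠ endorsed. Source: K. Joshi, *Construction of Arithmetic Teichmuller spaces II: Towards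
Diophantine Estimates*, arXiv:2111.04890 (2021), UNREFEREED preprint («draft»), bib `Joshi2021ATS2`; cell render
`HOME/lit/renders/Joshi-arxiv-2111.04890/pNNNN.txt` (19 corpus-TeX chunks; locators below are «§n, TeX label, chunk
pNNNN»; the only printed numbers known to the cell are those of the abstract: Theorem 7.8.1 = `pr:lift-vals`,
Theorem 10.1.1 = `th:main`). The paper's own disclaimer (§1, chunk p0004 l. 1–13): «Results of this paper do not give a new
proof of [Mochizuki, IUTchIII, Cor. 3.12]: simply because our two constructions each provide a set … as a subset of
different ambient sets … Theorem (th:main) is structurally similar but not the same».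

## What is typed here (OBJECTS as signatures, CLAIMED PROPERTIES as named `Prop`s, elementary consequences PROVED)

* `Carrier` — §2–§3 (chunks p0005–p0006): the closed points `y` of degree one of the complete Fargues–Fontaine curve
  `𝒳_{F,ℚ_p}`, `F = ℂ_p^♭` (equivalently characteristic-zero untilts `K_y` of `F` up to Frobenius), the elements `z`
  of `Ē` one evaluates (θ-values, `q`, `q^{1/2ℓ}`), the readings `|z|_{K_y} ∈ ℝ` («one can compare elements of
  `|K_1^*|` and `|K_2^*|` as elements of `|ℂ_p^{♭*}|`», §2), the normalisations `v_{K_y}(p)`, and the canonical point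
  `∞` (residue field `ℂ_p`, `v_{ℂ_p}(p) = 1`, §3). Claimed: `Carrier.Normalised` (§7, proof of Thm. 7.8.1: «the
  restriction of `|−|_{K_j}` to `E ⊂ K_j` is given by the above formula»: `|z|_{K_y} = |z|_{ℂ_p}^{v_{K_y}(p)}`).
* `ThetaValues` — §4–§6 (chunks p0007–p0009): `ℓ ≥ 3` prime, `ℓ* = (ℓ−1)/2`, a Tate curve with parameter `q`,
  `E ⊇ ℚ_p(q^{1/2ℓ}, ζ_{2ℓ})`, the θ-values `1/ξ_j = θ_M(q^{j/2ℓ}ζ_ℓ)/θ_M(ζ_ℓ) = (−1)^j q^{−j²/2ℓ} ζ_ℓ^{−2j}`,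
  `j = 1, …, ℓ*`. Claimed (computations from the quasi-periodicity of `θ_M`): `ThetaValues.Abs`
  (`0 < |q|_{ℂ_p} < 1`, `|ξ_1|_{ℂ_p} = |q|_{ℂ_p}^{1/2ℓ}`, `|ξ_j|_{ℂ_p} = |ξ_1|_{ℂ_p}^{j²}`).
* `Ansatz` — §7 (chunks p0010–p0012): **Mochizuki's Ansatz** `Σ_F = {([a]−p, [a^{2²}]−p, …, [a^{ℓ*²}]−p) : a ∈ 𝔪_F∖{0}}
  ⊂ 𝒳^{ℓ*}`, i.e. tuples `(y_1, …, y_{ℓ*})` of degree-one points with residue fields `(K_1, …, K_{ℓ*})`; «This is the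
  θ-link of Mochizuki's theory» (§7: the ansatz «`q = q^{j²}`»). Claimed: `Ansatz.ValScaling` (**Theorem 7.8.1**:
  `v_{K_j}(p) = v_F(a^{j²}) = j²·v_F(a) = j²·v_{K_1}(p)`), `Ansatz.CanonicalFirst` (eq-canonical-tuple: the tuple
  with `a = t = p^♭`, `K_1 = ℂ_p`), `Ansatz.CanonicalLast` (proof of Thm. 10.1.1, §10: `a_j = (t^{1/ℓ*²})^{j²}`, the
  tuple whose LAST residue field is `ℂ_p`).
* `Lifts` — §8 (chunk p0012): the ring `B = B_{ℚ_p}` with its Fréchet norms `|−|_ρ`, `ρ ∈ (0,1]`, Teichmüller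
  representatives `[x]`, `x ∈ 𝔪_F`, the relation «`b ∈ B` lifts `ξ` at `y`» (`η_{K_y}(b) = ξ`), the Tate modules
  `T_y ⊂ B^{φ=p}`. Claimed: `Lifts.TeichNorm` (`|[x]|_ρ = |x|_F`), `Lifts.TeichLiftExists` (Prop. `pr:teichmuller-lift-A`
  (1)(2): a Teichmüller lift `[x]` of `ξ` at `y` with `|x|_F = |ξ|_{K_y}` exists), `Lifts.TateShift` ((3): `τ + [x]`
  lifts `ξ` for `τ ∈ T_y`).
* PROVED from the named `Prop`s (elementary real arithmetic — the typed content of the printed proofs):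
  `Ansatz.absAt_tuple` (Thm. 7.8.1, third item: `|z|_{K_j} = |z|_{K_1}^{j²}`), `Lifts.teichNorm_tuple` (Prop.
  `pr:teichmuller-lift-B`: `|[x_j]|_ρ = |[x_1]|_ρ^{j²}`), `Lifts.prod_teichNorm_tuple` / `sum_log_teichNorm_tuple`
  (**Theorem `thm:theta-pilot-object-appears`**, §9 chunk p0013: `∏_j |[x_j]|_ρ = ∏_j |ξ|_{K_1}^{j²}`,
  `Σ_j log|[x_j]|_ρ = (Σ_j j²)·log|ξ|_{K_1}`).

## Modelling notes

(1) SIGNATURES, not constructions: the Fargues–Fontaine curve, `B`, Witt vectors and untilts are campaign-E objects of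
seat abc-iut-E-t1 ([J-I] arXiv:2106.11452, the Arithmetic Teichmüller space `𝔍(X,E)_{ℂ_p^♭}` whose objects are triples
`(Y/E′, E′ ↪ K)`, §4 chunk p0007); `Carrier.Pt` is to be instantiated by its untilt/degree-one-point type. Nothing of
[Fargues–Fontaine] is assumed beyond the named `Prop`s, each of which quotes the sentence of [J-II] that uses it.
(2) Labels: Joshi's `j = 1, …, ℓ*` is `i : Fin lstar` with `j = i + 1` (`Ansatz.jOf`), matching `Fin T.lstar` /
`Cor312.Setting.labelSucc` of the cell's Theorem 3.11 interface (`Thm311.ThetaIndex.lstar`); the dictionary to that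
interface ((Ind1)/(Ind2)/(Ind3), the pins, `S = Cor312Vol.PilotKummerIndRelated`) is the sequel `Joshi/ATS2Dictionary`.
(3) Real-valued readings: `|−|_{K_y}` and `|−|_ρ` are typed as real numbers (§2 places all value groups in
`|ℂ_p^{♭*}| ⊂ ℝ_{>0}`); `v_{K_y}(p)` is the real normalisation with `v_{ℂ_p}(p) = 1`.
Deliberately NOT here: `Θ̃ ⊂ B^{ℓ*}`, `|Θ̃|_B`, Theorem 10.1.1, Prop. `pr:trivial-upper-bound-on-ttheta` (sequel
`Joshi/ATS2ThetaLocus`); the log-links of §11 (`Joshi/ATS2LogLink`); any judgement.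
-/

noncomputable section

open Finset

namespace Summit.ABC.IUTFork.Joshi.ATS2

/-! ## 1. §2–§3: degree-one points of `𝒳_{F,ℚ_p}`, their residue fields, and the readings `|z|_{K_y}` -/

/-- **The ambient data of [J-II] §2–§3** (chunks p0005–p0006): the closed points `y` of degree one of `𝒳_{F,ℚ_p}`
(`F = ℂ_p^♭`; `|𝒴|/φ^ℤ ⥲ |𝒳| ≅ ℙ(V)`, `V = 𝒢(𝒪_F)`), with residue fields `K_y` (characteristic-zero untilts of `F`);
the evaluands `z ∈ Ē` (each `K_y` «contains a copy of the algebraic closure of `E`», §7, read through an embedding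
`ι_y`, `|z|_{K_y} := |ι_y(z)|_{K_y}`); the readings `|z|_{K_y}` in one value group («one can compare elements of
`|K_1^*|` and `|K_2^*|` as elements of `|ℂ_p^{♭*}|`», §2 Prop. `pa:value-group-comp-loc`); the normalisation
`v_{K_y}(p)`; the canonical point `∞` «whose residue field is identified with `ℂ_p` (with the standard valuation
`v_{ℂ_p}(p) = 1`)» (§3). SIGNATURE: objects only; to be instantiated by abc-iut-E-t1's [J-I] untilt type.
[claim: Joshi2021ATS2, status: disputed] -/
structure Carrier : Type 1 where
  /-- closed points of degree one of `𝒳_{F,ℚ_p}` -/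
  Pt : Type
  /-- the elements of `Ē` that get evaluated in the various `K_y` -/
  E : Type
  /-- `|z|_{K_y} ∈ ℝ_{≥0}` -/
  absAt : Pt → E → ℝ
  /-- `v_{K_y}(p) ∈ ℝ_{>0}` -/
  vp : Pt → ℝ
  /-- the canonical point `∞` (`K_∞ = ℂ_p`) -/
  canonical : Pt

namespace Carrier

variable (C : Carrier)

/-- `|z|_{ℂ_p}`: the reading at the canonical point. [claim: Joshi2021ATS2, status: disputed] -/
def absC (z : C.E) : ℝ := C.absAt C.canonical z

/-- **Normalisation of the readings** (§3 «`v_{ℂ_p}(p) = 1`»; §7, proof of Thm. 7.8.1, chunk p0011: «by loc. cit.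
the restriction of `|−|_{K_j}` to `E ⊂ K_j` is given by the above formula», i.e. an absolute value of `K_y`
restricted to `Ē ≅ \bar ℚ_p` is the `v_{K_y}(p)`-th power of the `ℂ_p`-one): readings are nonnegative,
normalisations positive, `v_{ℂ_p}(p) = 1`, and `|z|_{K_y} = |z|_{ℂ_p}^{v_{K_y}(p)}`. Named `Prop`, never asserted.
[claim: Joshi2021ATS2, status: disputed] -/
@[claim "Joshi2021ATS2" "disputed"] def Normalised : Prop :=
  (∀ y z, 0 ≤ C.absAt y z) ∧ (∀ y, 0 < C.vp y) ∧ C.vp C.canonical = 1 ∧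
    ∀ y z, C.absAt y z = C.absC z ^ C.vp y

/-- Under `Normalised`, `|z|_{ℂ_p} ≥ 0`. [folklore] -/
theorem absC_nonneg (h : C.Normalised) (z : C.E) : 0 ≤ C.absC z := h.1 C.canonical z

end Carrier

/-! ## 2. §4–§6: the index data and the θ-values -/

/-- **The θ-value data of [J-II] §4–§6** (chunks p0007–p0009) over a carrier: `ℓ* = (ℓ−1)/2` for an odd prime
`ℓ ≠ p` (`ℓ = 2ℓ* + 1`), the Tate parameter `q = q_C ∈ E^*` of the Tate curve `C/E` («`E` contains
`ℚ_p(q^{1/2ℓ}, ζ_{2ℓ})`», §4), and the θ-values `ξ_j`, `j = 1, …, ℓ*`, `1/ξ_j = θ_M(q^{j/2ℓ}ζ_ℓ)/θ_M(ζ_ℓ) =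
(−1)^j q^{−j²/2ℓ} ζ_ℓ^{−2j}` for the theta function `θ_M(u) = q^{−1/8} Σ_n q^{(n+1/2)²/2} u^{2n+1}` of
[Mochizuki, EtTh] (§5–§6; «`ξ_j ⊂ 𝒪_Ē ⊂ 𝒪_K`» for every algebraically closed perfectoid `K ⊇ E`). SIGNATURE.
[claim: Joshi2021ATS2, status: disputed] -/
structure ThetaValues (C : Carrier) where
  /-- `ℓ* = (ℓ − 1)/2` -/
  lstar : ℕ
  /-- the Tate parameter `q` -/
  q : C.E
  /-- the θ-values `ξ_{i+1}`, `i : Fin ℓ*` -/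
  xi : Fin lstar → C.E

namespace ThetaValues

variable {C : Carrier} (V : ThetaValues C)

/-- `ℓ = 2ℓ* + 1`. [claim: Joshi2021ATS2, status: disputed] -/
def l : ℕ := 2 * V.lstar + 1

/-- Joshi's label `j = i + 1 ∈ {1, …, ℓ*}` of the index `i : Fin ℓ*`. [folklore] -/
def jOf (i : Fin V.lstar) : ℕ := (i : ℕ) + 1

/-- **§6 (chunk p0009), the absolute values of the θ-values**, as Joshi computes them from the quasi-periodicity
`θ_M(q^{j/2}u) = (−1)^j q^{−j²/2} u^{−2j} θ_M(u)` of §5: `0 < |q|_{ℂ_p} < 1` («As `q` is the Tate parameter one has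
`|q|_{ℂ_p} < 1`», §9), `|ξ_1|_{ℂ_p} = |q^{1/2ℓ}|_{ℂ_p} = |q|_{ℂ_p}^{1/2ℓ}` (§10 «Now using `|ξ|_{ℂ_p} =
|q^{1/2ℓ}|_{ℂ_p}`»), and `|ξ_j|_{ℂ_p} = |ξ_1|_{ℂ_p}^{j²}` (§9: «one has from the definition of `ξ_1, …, ξ_{ℓ*}` that
`|ξ_j|_{ℂ_p} = |ξ_1|^{j²}_{ℂ_p}`»). Named `Prop`, never asserted. [claim: Joshi2021ATS2, status: disputed] -/
@[claim "Joshi2021ATS2" "disputed"] def Abs : Prop :=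
  0 < C.absC V.q ∧ C.absC V.q < 1 ∧
    (∀ i : Fin V.lstar, (i : ℕ) = 0 → C.absC (V.xi i) = C.absC V.q ^ ((1 : ℝ) / (2 * V.l))) ∧
    ∀ (i i₁ : Fin V.lstar), (i₁ : ℕ) = 0 → C.absC (V.xi i) = C.absC (V.xi i₁) ^ (V.jOf i) ^ 2

end ThetaValues

/-! ## 3. §7: Mochizuki's Ansatz `Σ_F` and the valuation scaling (Theorem 7.8.1) -/

/-- **MOCHIZUKI'S ANSATZ `Σ_F`** ([J-II] §7 Def., chunk p0010: «Let `Σ_F = {([a]−p, [a^{2²}]−p, [a^{3²}]−p, ⋯,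
[a^{ℓ*²}]−p) : a ∈ 𝔪_F − {0}}`»; «So any element … defines a tuple of closed points `(y_1, …, y_{ℓ*}) ∈ 𝒳^{ℓ*}` with
tuple of residue fields `(K_j)_{1 ≤ j ≤ ℓ*}`»; «This is the θ-link of Mochizuki's theory», i.e. the ansatz
«`(q^{1²}, q^{2²}, …, q^{ℓ*²}) = q`»), as a SIGNATURE over a carrier and θ-value data: the parameters
`a ∈ 𝔪_F∖{0}` with `v_F(a)`, and the tuple map `a ↦ (y_1, …, y_{ℓ*})`. Objects only; the printed properties
are the named `Prop`s below. [claim: Joshi2021ATS2, status: disputed] -/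
structure Ansatz {C : Carrier} (V : ThetaValues C) where
  /-- `𝔪_F ∖ {0}` -/
  Param : Type
  /-- `v_F(a) > 0` -/
  vF : Param → ℝ
  /-- `a ↦ (y_1, …, y_{ℓ*})`, `y_j ↔ ([a^{j²}] − p)` -/
  tuple : Param → Fin V.lstar → C.Pt

namespace Ansatz

variable {C : Carrier} {V : ThetaValues C} (A : Ansatz V)

/-- **[J-II] Theorem 7.8.1** (§7, TeX label `pr:lift-vals`, chunk p0011): «Let `(y_1, …, y_{ℓ*})` be closed points of
`𝒳` corresponding to an element of `Σ_F`. Then one has `v_{K_j}(p) = j² v_{K_1}(p)` for `j = 1, …, ℓ*`», via «The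
valuation of `K_j` can be computed from [Fargues–Fontaine] as `v_{K_j}(p) = v_F(a^{j²}) = j² v_F(a) = j² v_{K_1}(p)`».
Typed with the parameter's valuation: `v_F(a) > 0` and `v_{K_{y_j}}(p) = j²·v_F(a)`. Named `Prop`, never asserted.
[claim: Joshi2021ATS2, status: disputed] -/
@[claim "Joshi2021ATS2" "disputed"] def ValScaling : Prop :=
  (∀ a, 0 < A.vF a) ∧ ∀ (a : A.Param) (i : Fin V.lstar), C.vp (A.tuple a i) = (V.jOf i : ℝ) ^ 2 * A.vF a

/-- **The canonical tuple** (§7 eq-canonical-tuple, chunk p0010: «the tuple `([t]−p, [t^{2²}]−p, …, [t^{ℓ*²}]−p) ∈ Σ_F`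
in which the first factor corresponds to the canonical point of `𝒳`»; Thm. 7.8.1: «Notably if `K_1 = ℂ_p` then
`v_{K_j}(p) = j²`»): some parameter's FIRST point is the canonical point. Named `Prop`, never asserted.
[claim: Joshi2021ATS2, status: disputed] -/
@[claim "Joshi2021ATS2" "disputed"] def CanonicalFirst : Prop := ∀ i : Fin V.lstar, (i : ℕ) = 0 → ∃ a : A.Param, A.tuple a i = C.canonical

/-- **The tuple of the proof of Theorem 10.1.1** (§10, chunk p0015: «Choose a root `t^{1/ℓ*²} ∈ ℂ_p^♭`. Let for
`j = 1, ⋯, ℓ*`, `a_j = (t^{1/ℓ*²})^{j²}` … Then `([a_1]−p, …, [a_{ℓ*}]−p) ∈ Σ_F` … by construction `K_{ℓ*}` is the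
canonical point of `𝒳` notably the residue field `K_{ℓ*} = ℂ_p`»): some parameter's LAST point is the canonical
point. Named `Prop`, never asserted. [claim: Joshi2021ATS2, status: disputed] -/
@[claim "Joshi2021ATS2" "disputed"] def CanonicalLast : Prop := ∀ i : Fin V.lstar, (i : ℕ) + 1 = V.lstar → ∃ a : A.Param, A.tuple a i = C.canonical

/-- `|z|_{K_1}`-scale base of the parameter `a`: `|z|_{ℂ_p}^{v_F(a)}` (the reading at the first point of the tuple,
`absAt_tuple_first`). [claim: Joshi2021ATS2, status: disputed] -/
def absBase (a : A.Param) (z : C.E) : ℝ := C.absC z ^ A.vF a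

/-- The base reading is nonnegative. [folklore] -/
theorem absBase_nonneg (hC : C.Normalised) (a : A.Param) (z : C.E) : 0 ≤ A.absBase a z :=
  Real.rpow_nonneg (C.absC_nonneg hC z) _

/-- **Theorem 7.8.1, third item, PROVED from the named `Prop`s** (§7 chunk p0011: «Hence for `z ∈ Ē ⊂ K_j`, for
`j = 1, …, ℓ*` one has `|z|_{K_j} = |z|_{K_1}^{j²}`»): along an Ansatz tuple the reading at the `j`-th point is the
`j²`-th power of the base reading. [claim: Joshi2021ATS2, status: disputed] -/
theorem absAt_tuple (hC : C.Normalised) (hA : A.ValScaling) (a : A.Param) (i : Fin V.lstar) (z : C.E) :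
    C.absAt (A.tuple a i) z = A.absBase a z ^ (V.jOf i) ^ 2 := by
  rw [hC.2.2.2, hA.2 a i, absBase, mul_comm, Real.rpow_mul (C.absC_nonneg hC z), ← Real.rpow_natCast]
  norm_cast

/-- At the first point (`j = 1`) the reading IS the base reading `|z|_{K_1}`. [folklore] -/
theorem absAt_tuple_first (hC : C.Normalised) (hA : A.ValScaling) (a : A.Param) (i : Fin V.lstar)
    (hi : (i : ℕ) = 0) (z : C.E) : C.absAt (A.tuple a i) z = A.absBase a z := by
  rw [A.absAt_tuple hC hA a i z, ThetaValues.jOf, hi]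
  simp

/-- Theorem 7.8.1 in Joshi's form `|z|_{K_j} = |z|_{K_1}^{j²}` (both points of the same tuple). [claim: Joshi2021ATS2, status: disputed] -/
theorem absAt_tuple_eq_pow_first (hC : C.Normalised) (hA : A.ValScaling) (a : A.Param) (i i₁ : Fin V.lstar)
    (hi₁ : (i₁ : ℕ) = 0) (z : C.E) :
    C.absAt (A.tuple a i) z = C.absAt (A.tuple a i₁) z ^ (V.jOf i) ^ 2 := by
  rw [A.absAt_tuple_first hC hA a i₁ hi₁, A.absAt_tuple hC hA]

/-- Theorem 7.8.1, second item: at a tuple whose first point is canonical, `v_{K_j}(p) = j²`. [claim: Joshi2021ATS2, status: disputed] -/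
theorem vp_tuple_of_first_canonical (hC : C.Normalised) (hA : A.ValScaling) (a : A.Param) (i i₁ : Fin V.lstar)
    (hi₁ : (i₁ : ℕ) = 0) (ha : A.tuple a i₁ = C.canonical) : C.vp (A.tuple a i) = (V.jOf i : ℝ) ^ 2 := by
  have h1 : C.vp (A.tuple a i₁) = (V.jOf i₁ : ℝ) ^ 2 * A.vF a := hA.2 a i₁
  rw [ha, hC.2.2.1, ThetaValues.jOf, hi₁] at h1
  have hvF : A.vF a = 1 := by simpa using h1.symm
  rw [hA.2 a i, hvF, mul_one]

/-- At a tuple whose LAST point is canonical (proof of Thm. 10.1.1): `v_F(a) = 1/ℓ*²`, i.e. `v_{K_1}(p) = 1/ℓ*²`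
(§10 chunk p0015: «hence one has `v_{K_1}(p) = (1/ℓ*²)·v_{ℂ_p}(p)`»). [claim: Joshi2021ATS2, status: disputed] -/
theorem vF_of_last_canonical (hC : C.Normalised) (hA : A.ValScaling) (a : A.Param) (i : Fin V.lstar)
    (hi : (i : ℕ) + 1 = V.lstar) (ha : A.tuple a i = C.canonical) : A.vF a = 1 / (V.lstar : ℝ) ^ 2 := by
  have h1 : C.vp (A.tuple a i) = (V.jOf i : ℝ) ^ 2 * A.vF a := hA.2 a i
  rw [ha, hC.2.2.1, ThetaValues.jOf, hi] at h1
  have hl : (0 : ℝ) < (V.lstar : ℝ) ^ 2 := by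
    have : 0 < V.lstar := by omega
    positivity
  rw [eq_div_iff hl.ne']
  linarith [h1]

end Ansatz

/-! ## 4. §8: lifting θ-values to `B` — Teichmüller lifts and Tate-module shifts -/

/-- **The lifting data of [J-II] §8** (chunk p0012): the ring `B = B_{ℚ_p}` of [Fargues–Fontaine] with «the
multiplicative norms `|−|_ρ`, `ρ ∈ (0,1) ⊂ ℝ`, defining the Fréchet structure of `B`» (extended to `ρ = 1`, §10), the
Teichmüller representatives `[x] ∈ W(𝒪_F) ⊂ B`, `x ∈ 𝔪_F`, with `|x|_F`, the relation «`b` lifts the θ-value `ξ` at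
`y`» (`η_{K_y}(b) = ξ` for the canonical surjection `η_{K_y} : W(𝒪_F) → 𝒪_{K_y}`, «traditionally denoted by `θ`»),
and the Tate modules `T_y = T_{K_y} ⊂ B^{φ=p} ⊂ B` («a free `ℤ_p`-module of rank one»). SIGNATURE over the
additive group of `B` (only its additive structure is used: the lifts `τ + [x]`). [claim: Joshi2021ATS2, status: disputed] -/
structure Lifts (C : Carrier) (B : Type) [AddCommGroup B] : Type 1 where
  /-- `|b|_ρ` for `ρ ∈ (0, 1]` -/
  norm : ℝ → B → ℝ
  /-- `𝔪_F` -/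
  MF : Type
  /-- `|x|_F` -/
  absF : MF → ℝ
  /-- the Teichmüller representative `[x] ∈ B` -/
  teich : MF → B
  /-- «`b` lifts `ξ` at `y`»: `η_{K_y}(b) = ι_y(ξ)` -/
  LiftsAt : C.Pt → B → C.E → Prop
  /-- the Tate module `T_y ⊂ B^{φ=p} ⊂ B` -/
  T : C.Pt → Set B

namespace Lifts

variable {C : Carrier} {B : Type} [AddCommGroup B] (L : Lifts C B)

/-- **`|[x]|_ρ = |x|_F`** for every `ρ ∈ (0, 1]` (Prop. `pr:teichmuller-lift-A` (2), chunk p0012: «`|[x]|_ρ = |x|_F =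
|ξ|_{K_y}`», «uses just the definition of `|−|_{K_y}` given by [Fargues–Fontaine]»; §10: «by the definition of `|−|_1`
… one has `|[x]|_1 = |x|_F`»). Named `Prop`, never asserted. [claim: Joshi2021ATS2, status: disputed] -/
@[claim "Joshi2021ATS2" "disputed"] def TeichNorm : Prop := ∀ ρ : ℝ, 0 < ρ → ρ ≤ 1 → ∀ x : L.MF, L.norm ρ (L.teich x) = L.absF x

/-- **Existence of Teichmüller lifts with the right size** (Prop. `pr:teichmuller-lift-A` (1)(2), chunk p0012: «there
exists `x ∈ 𝔪_F ⊂ 𝒪_F` such that `η_{K_y}([x]) = ξ`», «`|[x]|_ρ = |x|_F = |ξ|_{K_y}`»; «a consequence of [Fargues–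
Fontaine] which asserts that there exists a Teichmuller lift of every element of `𝒪_K`»), for the θ-values of `V`.
Named `Prop`, never asserted. [claim: Joshi2021ATS2, status: disputed] -/
@[claim "Joshi2021ATS2" "disputed"] def TeichLiftExists (V : ThetaValues C) : Prop :=
  ∀ (y : C.Pt) (i : Fin V.lstar), ∃ x : L.MF, L.LiftsAt y (L.teich x) (V.xi i) ∧ L.absF x = C.absAt y (V.xi i)

/-- **Tate-module shifts of lifts are lifts** (Prop. `pr:teichmuller-lift-A` (3), chunk p0012: «for any `τ ∈ T_y ⊂
B^{φ=p}` one has `η_{K_y}(τ + [x]) = ξ`», «immediate from the fact that `ker(η_{K_y}) ⊃ T_y`»). Named `Prop`, never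
asserted. [claim: Joshi2021ATS2, status: disputed] -/
@[claim "Joshi2021ATS2" "disputed"] def TateShift : Prop := ∀ (y : C.Pt) (b : B) (z : C.E) (τ : B), L.LiftsAt y b z → τ ∈ L.T y → L.LiftsAt y (τ + b) z

/-- A **Teichmüller lift tuple** of the θ-value `ξ_{i₀+1}` along an Ansatz tuple (§8 Prop. `pr:teichmuller-lift-B`,
chunk p0012: «Let `[x_j] ∈ W(𝒪_F) ⊂ B` be a Teichmuller lift of `ξ_1` under `η_{K_j} : W(𝒪_F) → 𝒪_{K_j}` … for
`j = 1, …, ℓ*`»): representatives `x_j` with `[x_j]` lifting `ξ` at `y_j` and `|x_j|_F = |ξ|_{K_j}`.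
[claim: Joshi2021ATS2, status: disputed] -/
structure LiftTuple {V : ThetaValues C} (A : Ansatz V) (a : A.Param) (i₀ : Fin V.lstar) where
  /-- `x_j ∈ 𝔪_F`, `j = 1, …, ℓ*` -/
  x : Fin V.lstar → L.MF
  /-- `η_{K_j}([x_j]) = ξ` -/
  lifts : ∀ i, L.LiftsAt (A.tuple a i) (L.teich (x i)) (V.xi i₀)
  /-- `|x_j|_F = |ξ|_{K_j}` -/
  absF_eq : ∀ i, L.absF (x i) = C.absAt (A.tuple a i) (V.xi i₀)

/-- Under `TeichLiftExists`, every Ansatz tuple carries a Teichmüller lift tuple of every θ-value. [folklore] -/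
theorem nonempty_liftTuple {V : ThetaValues C} (A : Ansatz V) (h : L.TeichLiftExists V) (a : A.Param)
    (i₀ : Fin V.lstar) : Nonempty (L.LiftTuple A a i₀) := by
  choose x hx using fun i => h (A.tuple a i) i₀
  exact ⟨⟨x, fun i => (hx i).1, fun i => (hx i).2⟩⟩

variable {L}

/-- **Prop. `pr:teichmuller-lift-B` PROVED from the named `Prop`s** (chunk p0012: «Then one has `|[x_j]|_ρ =
|[x_1]|_ρ^{j²}`. This is clear from Proposition (pr:lift-vals) and the fact that `[x_j]` is a lift of `ξ_1` under
`η_{K_j}`, and hence `|[x_j]|_ρ = |ξ_1|_{K_j} = |ξ_1|_{K_1}^{j²} = |[x_1]|_ρ^{j²}`»): the norm of the `j`-th lift is the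
`j²`-th power of the base reading of `ξ`. [claim: Joshi2021ATS2, status: disputed] -/
theorem teichNorm_tuple (hC : C.Normalised) (hT : L.TeichNorm) {V : ThetaValues C} {A : Ansatz V}
    (hA : A.ValScaling) {a : A.Param} {i₀ : Fin V.lstar} (t : L.LiftTuple A a i₀) {ρ : ℝ} (hρ : 0 < ρ)
    (hρ1 : ρ ≤ 1) (i : Fin V.lstar) :
    L.norm ρ (L.teich (t.x i)) = A.absBase a (V.xi i₀) ^ (V.jOf i) ^ 2 := by
  rw [hT ρ hρ hρ1, t.absF_eq i, A.absAt_tuple hC hA]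

/-- `|[x_j]|_ρ = |[x_1]|_ρ^{j²}`, literally. [claim: Joshi2021ATS2, status: disputed] -/
theorem teichNorm_tuple_eq_pow_first (hC : C.Normalised) (hT : L.TeichNorm) {V : ThetaValues C} {A : Ansatz V}
    (hA : A.ValScaling) {a : A.Param} {i₀ : Fin V.lstar} (t : L.LiftTuple A a i₀) {ρ : ℝ} (hρ : 0 < ρ)
    (hρ1 : ρ ≤ 1) (i i₁ : Fin V.lstar) (hi₁ : (i₁ : ℕ) = 0) :
    L.norm ρ (L.teich (t.x i)) = L.norm ρ (L.teich (t.x i₁)) ^ (V.jOf i) ^ 2 := by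
  rw [teichNorm_tuple hC hT hA t hρ hρ1 i, teichNorm_tuple hC hT hA t hρ hρ1 i₁]
  simp [ThetaValues.jOf, hi₁]

/-! ## 5. §9, Theorem `thm:theta-pilot-object-appears`: «the Θ-pilot object appears» -/

/-- **[J-II] Theorem `thm:theta-pilot-object-appears`, product form, PROVED from the named `Prop`s** (§9 chunk
p0013: «Let `[x_j]` be a Teichmuller lift to `B` of `ξ_1` under `η_{K_j}`. Then `∏_{j=1}^{ℓ*} |[x_j]|_ρ =
∏_{j=1}^{ℓ*} |ξ|_{K_1}^{j²}`»; «The proof follows by putting together Proposition (pr:teichmuller-lift-A) and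
Proposition (pr:teichmuller-lift-B)»). [claim: Joshi2021ATS2, status: disputed] -/
theorem prod_teichNorm_tuple (hC : C.Normalised) (hT : L.TeichNorm) {V : ThetaValues C} {A : Ansatz V}
    (hA : A.ValScaling) {a : A.Param} {i₀ : Fin V.lstar} (t : L.LiftTuple A a i₀) {ρ : ℝ} (hρ : 0 < ρ)
    (hρ1 : ρ ≤ 1) :
    ∏ i : Fin V.lstar, L.norm ρ (L.teich (t.x i)) = ∏ i : Fin V.lstar, A.absBase a (V.xi i₀) ^ (V.jOf i) ^ 2 :=
  Finset.prod_congr rfl fun i _ => teichNorm_tuple hC hT hA t hρ hρ1 i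

/-- The product of the powers is one power: `∏_j |ξ|^{j²} = |ξ|^{Σ_j j²}`. [folklore] -/
theorem prod_absBase_pow {V : ThetaValues C} (A : Ansatz V) (a : A.Param) (z : C.E) :
    ∏ i : Fin V.lstar, A.absBase a z ^ (V.jOf i) ^ 2 = A.absBase a z ^ ∑ i : Fin V.lstar, (V.jOf i) ^ 2 :=
  (Finset.prod_pow_eq_pow_sum _ _ _)

/-- **Theorem `thm:theta-pilot-object-appears`, additive form, PROVED** (§9 chunk p0013: «or additively this is
`Σ_{j=1}^{ℓ*} log|[x_j]|_ρ = Σ_{j=1}^{ℓ*} j²·log|ξ|_{K_1}`»). Joshi (ibid.): «The quantity `(1/ℓ*)·Σ_j j²·log|ξ|_{ℂ_p}`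
appears in the definition of the "arithmetic degree of the hull of θ-pilot object" in [IUTchIII, Cor. 3.12]»; no
such identification is made or used here. [claim: Joshi2021ATS2, status: disputed] -/
theorem sum_log_teichNorm_tuple (hC : C.Normalised) (hT : L.TeichNorm) {V : ThetaValues C} {A : Ansatz V}
    (hA : A.ValScaling) {a : A.Param} {i₀ : Fin V.lstar} (t : L.LiftTuple A a i₀) {ρ : ℝ} (hρ : 0 < ρ)
    (hρ1 : ρ ≤ 1) :
    ∑ i : Fin V.lstar, Real.log (L.norm ρ (L.teich (t.x i))) =
      (∑ i : Fin V.lstar, ((V.jOf i : ℝ) ^ 2)) * Real.log (A.absBase a (V.xi i₀)) := by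
  rw [Finset.sum_mul]
  refine Finset.sum_congr rfl fun i _ => ?_
  rw [teichNorm_tuple hC hT hA t hρ hρ1 i, Real.log_pow]
  push_cast
  ring

/-- **The Tate-shifted lifts** `[x_j] + τ_j`, `τ_j ∈ T_{y_j}` (Thm. `thm:theta-pilot-object-appears`, third item, chunk
p0013: «one can replace the Teichmuller lifts `|[x_j]|_ρ` by `|[x_j] + τ_j|_ρ` where `τ_j ∈ T_{y_j}` … and work with
the supremum of all such values»): every such shift lifts the same θ-value (from `TateShift`). [claim: Joshi2021ATS2, status: disputed] -/
theorem liftsAt_shift (hS : L.TateShift) {V : ThetaValues C} {A : Ansatz V} {a : A.Param} {i₀ : Fin V.lstar}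
    (t : L.LiftTuple A a i₀) (τ : Fin V.lstar → B) (hτ : ∀ i, τ i ∈ L.T (A.tuple a i)) (i : Fin V.lstar) :
    L.LiftsAt (A.tuple a i) (τ i + L.teich (t.x i)) (V.xi i₀) :=
  hS _ _ _ _ (t.lifts i) (hτ i)

end Lifts

end Summit.ABC.IUTFork.Joshi.ATS2

end
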